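import Literature.MathematicalPhysics.QuantumFieldTheory.King1986.CovarianceQstarRate
import HarnessLib

/-!
# King 1986, p. 675: the top-scale piece `G^η_{(K)} = C^η − G^η_K` of the propagator decomposition (2.17) —
# its kernel as `Σ_b C^ηQ^*_K(x, b)·ℋ_K(y, b)`, Proposition 3.7 (decay) and Proposition 3.8-type two-spacing rate

**Citation header (reproduction of PUBLISHED and PROVED work; seat `pub-ymgap-dag-n18-b` (g2) of the cell `pub-ymgap`,
Track-A node N18 = NE5 whose PRINTED MODEL of record is King's Prop. 3.8 ∕ 3.9; seventeenth file of the seat's chain —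
the one-line assembly announced in `CovarianceQstarRate`: King p. 675 «Finally, we must establish Propositions 3.7 and 3.9
for G^η_{(K)} = C^η − G^η_K … (4.44) … Finally, Proposition 3.9 holds for G^η_{(K)} from the convergence of C^ηQ^*_K and
a_KQ_KG^η_K, and the scalings of the operators».)**
C. King, *The U(1) Higgs model. I. The continuum limit*, Commun. Math. Phys. **102** (1986) 649–677 [King1986], §4 p. 675
(4.44)–(4.45); (2.17) p. 653; Prop. 3.7 p. 663, Prop. 3.8 p. 664, Prop. 3.9 p. 665.  TEMPLATE LITERATURE (printed and proved
`A = 0` mechanism); nothing here is about Bałaban's covariant objects.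

**What this file PROVES (kernel).**
* §1 `topPiece N M a c m² := N^d·(B⁻¹ − A₀⁻¹)` (King's `G^η_{(K)} = C^η − G^η_K` in the conventions of `minimiser` ∕ `covQstar`:
  `C^η = N^dB⁻¹`, `G^η_K = N^dA₀⁻¹`) and **`topPiece_kernel_eq_sum`**: `G^η_{(K)}(x, y) = Σ_b C^ηQ^*_K(x, b)·ℋ_K(y, b)` — (4.44)
  `C^η − G^η_K = C^ηQ^*_K·a_KQ_KG^η_K` read entrywise (`resolvent_444`, `Q*Q = N^dQᵀQ`, symmetry of `A₀⁻¹`).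
* §2 **`topPiece_decay_blocks`** — PROP. 3.7 FOR `G^η_{(K)}` on Bałaban's volumes: `|G^η_{(K)}(x, y)| ≤ c·e^{−δ·tdistT M (B x)(B y)}`
  (`covQstar_kernel_decay_blocks` ⊛ `minimiser_kernel_decay_blocks` via `exp_conv_le`).
* §3 **`topPiece_rate_blocks`** — the two-spacing rate («Proposition 3.9 holds for G^η_{(K)} from the convergence of C^ηQ^*_K
  and a_KQ_KG^η_K»): for `0 ≤ γ ≤ 1`, `|G^η_{(K),(n)}(x′, y′) − G^η_{(K)}(x, y)| ≤ (c·√((C₁′+C₂′)(L^K)^{−γ}) + c·(L^K)⁻¹)·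
  e^{−δ·tdistT M (B x)(B y)}` for fine points `x′, y′` over `x, y` — `C′ℋ′ − Cℋ = (C′ − C)ℋ′ + C(ℋ′ − ℋ)` with
  `covQstar_row_rate`, `king_prop38_torus_blocks` and the two decays.

**NOT COVERED.**  Prop. 3.9's `t`-derivative clauses (3.74)–(3.75) for `G^η_{(K)}` (the `t`-dependence enters through
`m²(t)` only and is not typed in this chain); Hölder ∕ derivative lines for `G^η_{(K)}`; even `L`; `A ≠ 0`.  HONEST FRAMING:
King's `A = 0` scalar MODEL on a finite torus; nothing about Bałaban's covariant objects; nothing continuum ∕ mass-gap ∕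
Clay; count-neutral for the cell's 27 nodes.
-/

noncomputable section

open Finset Real Matrix
open scoped BigOperators

namespace Literature.MathematicalPhysics.QuantumFieldTheory.King1986

open Literature.MathematicalPhysics.QuantumFieldTheory.Balaban1983to89 (Params)
open Literature.MathematicalPhysics.QuantumFieldTheory.Balaban1983to89.B5Prop11Plancherel
open Literature.MathematicalPhysics.QuantumFieldTheory.Balaban1983to89.B4Sect5Torus (IsPseudoDist SumBound)

namespace Torus

variable {d : ℕ}

/-! ## §1 `G^η_{(K)} = C^η − G^η_K` and its kernel -/

section Kernel

variable (N : ℕ) [NeZero N] (M : Fin d → ℕ) [hM : ∀ μ, NeZero (M μ)]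

/-- King's top-scale piece `G^η_{(K)} = C^η − G^η_K` in the conventions of `minimiser` ∕ `covQstar`: `N^d·(B⁻¹ − A₀⁻¹)`,
`B = c(−Δ) + m²`, `A₀ = B + a·Q*Q`. [cite: King1986, (2.17) p.653, (4.44) p.675] -/
def topPiece (a c m2 : ℝ) : Matrix (Tor (fine N M)) (Tor (fine N M)) ℝ :=
  ((N : ℝ) ^ d) • ((lapF (fine N M) c m2)⁻¹ - (fineOp N M a c m2)⁻¹)

/-- **`G^η_{(K)}(x, y) = Σ_b C^ηQ^*_K(x, b)·ℋ_K(y, b)`** — (4.44) read entrywise (`a ≥ 0`, `c ≥ 0`, `m² > 0`).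
[cite: King1986, (4.44) p.675] -/
theorem topPiece_kernel_eq_sum {a c m2 : ℝ} (ha : 0 ≤ a) (hc : 0 ≤ c) (hm : 0 < m2) (x y : Tor (fine N M)) :
    topPiece N M a c m2 x y
      = ∑ b : Tor M, covQstar N M c m2 (Pi.single b 1) x * minimiser N M a c m2 (Pi.single b 1) y := by
  have hNd : ((N : ℝ) ^ d) ≠ 0 := pow_ne_zero _ (by exact_mod_cast NeZero.ne N)
  -- (4.44) and `blockProj = N^d QᵀQ`
  have hP : blockProj N M = ((N : ℝ) ^ d) • ((Qmat N M)ᵀ * Qmat N M) := by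
    rw [transpose_Qmat_mul_Qmat, smul_smul, mul_inv_cancel₀ hNd, one_smul]
  have h444 := resolvent_444 N M ha hc hm
  -- symmetry of `A₀⁻¹`
  have hAt : ((fineOp N M a c m2)⁻¹)ᵀ = (fineOp N M a c m2)⁻¹ := by
    rw [Matrix.transpose_nonsing_inv, fineOp_transpose]
  -- entrywise
  rw [topPiece, Matrix.smul_apply, h444, hP, Matrix.mul_smul, Matrix.smul_mul, Matrix.smul_apply, smul_eq_mul,
    smul_eq_mul, Matrix.smul_apply, smul_eq_mul,
    ← Matrix.mul_assoc ((lapF (fine N M) c m2)⁻¹) ((Qmat N M)ᵀ) (Qmat N M),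
    Matrix.mul_assoc ((lapF (fine N M) c m2)⁻¹ * (Qmat N M)ᵀ) (Qmat N M) ((fineOp N M a c m2)⁻¹),
    Matrix.mul_apply, Finset.mul_sum, Finset.mul_sum, Finset.mul_sum]
  refine Finset.sum_congr rfl fun b _ => ?_
  have hsym : ((fineOp N M a c m2)⁻¹ * (Qmat N M)ᵀ) y b = (Qmat N M * (fineOp N M a c m2)⁻¹) b y := by
    rw [← Matrix.transpose_apply (Qmat N M * (fineOp N M a c m2)⁻¹) y b, Matrix.transpose_mul, hAt]
  rw [covQstar, minimiser, Matrix.mulVec_mulVec, Matrix.mulVec_mulVec, Pi.smul_apply, Pi.smul_apply, smul_eq_mul,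
    smul_eq_mul, Matrix.mulVec_single_one, Matrix.mulVec_single_one, Matrix.col_apply, Matrix.col_apply, hsym]
  ring

end Kernel

/-! ## §2 Proposition 3.7 for `G^η_{(K)}` on Bałaban's volumes -/

/-- **PROPOSITION 3.7 FOR THE TOP-SCALE PIECE `G^η_{(K)}` ON BAŁABAN'S VOLUMES**: for `d ≥ 1`, odd `L ≥ 2`, `a > 0`,
`m² > 0` there are `δ, c > 0` (functions of `d, L, a, m²`) with `|G^η_{(K)}(x, y)| ≤ c·exp(−δ·tdistT M (B x) (B y))` for every
volume (`K ≥ 1`), every spelling `N = L^K` and all fine points `x, y`. [cite: King1986, p.675, Prop. 3.7 (3.64) p.663] -/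
theorem topPiece_decay_blocks (dd L : ℕ) (hd : 1 ≤ dd) (hLodd : Odd L) (hL : 2 ≤ L) {a m2 : ℝ} (ha : 0 < a)
    (hm : 0 < m2) :
    ∃ δ c : ℝ, 0 < δ ∧ 0 < c ∧ ∀ (P : Params), P.d = dd → P.L = L → 1 ≤ P.K →
      ∀ (M : Fin P.d → ℕ) [∀ μ, NeZero (M μ)] (_hMK : ∀ μ, M μ = P.sitesPerDir P.K)
        (N : ℕ) [NeZero N] (_hN : N = P.L ^ P.K) (xt yt : Tor (fine N M)),
        |topPiece N M (aK a P.L P.K) (((N : ℕ) : ℝ) ^ 2) m2 xt yt|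
          ≤ c * Real.exp (-(δ * tdistT M (blockOf N M xt) (blockOf N M yt))) := by
  have hL1 : 1 < L := by omega
  obtain ⟨δ₀, c₀, hδ₀, hc₀, Hmin⟩ := minimiser_kernel_decay_blocks dd L hd ⟨hLodd, hL1⟩ ha hm.le
  obtain ⟨δ₁, c₁, hδ₁, hc₁, Hcov⟩ := covQstar_kernel_decay_blocks dd L hd hLodd hL ha hm
  set δ : ℝ := min δ₀ δ₁ / 2 with hδdef
  have hδ0 : 0 < δ := by rw [hδdef]; exact half_pos (lt_min hδ₀ hδ₁)
  have hδA : 2 * δ ≤ δ₁ := by rw [hδdef]; linarith [min_le_right δ₀ δ₁]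
  have hδB : 2 * δ ≤ δ₀ := by rw [hδdef]; linarith [min_le_left δ₀ δ₁]
  set Kd := Balaban1983to89.B4Sect5Proof.latticeConst dd with hKd
  have hKdδ : 0 ≤ Kd δ := latticeConst_profile_nonneg dd δ hδ0
  refine ⟨δ, c₁ * (a * c₀) * Kd δ + 1, hδ0, by positivity, ?_⟩
  intro P hPd hPL hK M _ hMK N _ hN xt yt
  have hLr : (1 : ℝ) < P.L := by exact_mod_cast P.hL.2
  have hN1 : 1 ≤ N := by rw [hN]; exact Nat.one_le_pow _ _ (by have := P.hL.2; omega)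
  have haK : 0 < aK a P.L P.K := aK_pos ha hLr hK
  rw [topPiece_kernel_eq_sum N M haK.le (by positivity) hm xt yt]
  have hterm : ∀ b : Tor M,
      |covQstar N M (((N : ℕ) : ℝ) ^ 2) m2 (Pi.single b 1) xt * minimiser N M (aK a P.L P.K) (((N : ℕ) : ℝ) ^ 2) m2
          (Pi.single b 1) yt|
        ≤ c₁ * (a * c₀) * (Real.exp (-(δ₁ * tdistT M (blockOf N M xt) b))
            * Real.exp (-(δ₀ * tdistT M b (blockOf N M yt)))) := by
    intro b
    rw [abs_mul]
    have h1 := Hcov P hPd hPL hK M hMK N hN xt b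
    have h2 : |minimiser N M (aK a P.L P.K) (((N : ℕ) : ℝ) ^ 2) m2 (Pi.single b 1) yt|
        ≤ a * c₀ * Real.exp (-(δ₀ * tdistT M b (blockOf N M yt))) := by
      rw [tdistT_symm]
      exact (Hmin P hPd hPL hK M hMK N hN yt b).trans
        (mul_le_mul_of_nonneg_right (mul_le_mul_of_nonneg_right (aK_le ha hLr hK) hc₀.le) (Real.exp_pos _).le)
    calc |covQstar N M (((N : ℕ) : ℝ) ^ 2) m2 (Pi.single b 1) xt|
          * |minimiser N M (aK a P.L P.K) (((N : ℕ) : ℝ) ^ 2) m2 (Pi.single b 1) yt|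
        ≤ (c₁ * Real.exp (-(δ₁ * tdistT M (blockOf N M xt) b)))
          * (a * c₀ * Real.exp (-(δ₀ * tdistT M b (blockOf N M yt)))) :=
          mul_le_mul h1 h2 (abs_nonneg _) (by positivity)
      _ = _ := by ring
  have hpd : IsPseudoDist (tdistT M) := tdistT_isPseudoDist M
  have hconv := exp_conv_le hpd (tdistT_sumBound M) (κ₁ := δ₁) (κ₂ := δ₀) hδ0 hδA hδB
    (blockOf N M xt) (blockOf N M yt)
  have hK' : Balaban1983to89.B4Sect5Proof.latticeConst P.d δ = Kd δ := by rw [hKd, hPd]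
  rw [hK'] at hconv
  calc |∑ b : Tor M, covQstar N M (((N : ℕ) : ℝ) ^ 2) m2 (Pi.single b 1) xt
          * minimiser N M (aK a P.L P.K) (((N : ℕ) : ℝ) ^ 2) m2 (Pi.single b 1) yt|
      ≤ ∑ b : Tor M, |covQstar N M (((N : ℕ) : ℝ) ^ 2) m2 (Pi.single b 1) xt
          * minimiser N M (aK a P.L P.K) (((N : ℕ) : ℝ) ^ 2) m2 (Pi.single b 1) yt| :=
        Finset.abs_sum_le_sum_abs _ _
    _ ≤ ∑ b : Tor M, c₁ * (a * c₀) * (Real.exp (-(δ₁ * tdistT M (blockOf N M xt) b))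
            * Real.exp (-(δ₀ * tdistT M b (blockOf N M yt)))) := Finset.sum_le_sum fun b _ => hterm b
    _ = c₁ * (a * c₀) * ∑ b : Tor M, Real.exp (-(δ₁ * tdistT M (blockOf N M xt) b))
            * Real.exp (-(δ₀ * tdistT M b (blockOf N M yt))) := by rw [Finset.mul_sum]
    _ ≤ c₁ * (a * c₀) * (Kd δ * Real.exp (-(δ * tdistT M (blockOf N M xt) (blockOf N M yt)))) :=
        mul_le_mul_of_nonneg_left hconv (by positivity)
    _ ≤ (c₁ * (a * c₀) * Kd δ + 1) * Real.exp (-(δ * tdistT M (blockOf N M xt) (blockOf N M yt))) := by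
        rw [← mul_assoc]
        exact mul_le_mul_of_nonneg_right (by linarith) (Real.exp_pos _).le

/-! ## §3 The two-spacing rate of `G^η_{(K)}` on Bałaban's volumes -/

/-- **THE TWO-SPACING RATE OF `G^η_{(K)}`** («Proposition 3.9 holds for G^η_{(K)} from the convergence of C^ηQ^*_K and
a_KQ_KG^η_K», p. 675), in the currency of `king_prop38_torus_blocks`: for `d ≥ 1`, odd `L ≥ 2`, `a > 0`, `m² > 0`,
`0 ≤ γ ≤ 1` there are `δ, c > 0` such that for every volume, every `n ≥ 1`, fine points `x′, y′` of the `L^{K+n}`-lattice over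
fine points `x, y` of the `L^K`-lattice:
`|G^η_{(K),(n)}(x′, y′) − G^η_{(K)}(x, y)| ≤ (c·√((C₁′ + C₂′)(L^K)^{−γ}) + c·(L^K)⁻¹)·exp(−δ·tdistT M (B x) (B y))`,
`C₁′ = prop38RateConst a a (lemma43Const a L K n) ((π²∕4)^d) d γ`, `C₂′ = prop38PosConst a ((π²∕4)^d) d γ`.
[cite: King1986, p.675, Prop. 3.8 (3.71) p.664, Prop. 3.9 p.665] -/
theorem topPiece_rate_blocks (dd L : ℕ) (hd : 1 ≤ dd) (hLodd : Odd L) (hL : 2 ≤ L) {a m2 : ℝ} (ha : 0 < a)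
    (hm : 0 < m2) {γ : ℝ} (hγ0 : 0 ≤ γ) (hγ1 : γ ≤ 1) :
    ∃ δ c : ℝ, 0 < δ ∧ 0 < c ∧ ∀ (P : Params) (_hPd : P.d = dd) (_hPL : P.L = L) (_hK : 1 ≤ P.K) [NeZero P.L]
      (n : ℕ) (_hn : 1 ≤ n) (M : Fin P.d → ℕ) [∀ μ, NeZero (M μ)] (_hMK : ∀ μ, M μ = P.sitesPerDir P.K)
      (xt yt : Tor (fine (P.L ^ P.K) M)) (xt' yt' : Tor (fine (P.L ^ n * P.L ^ P.K) M))
      (_hxx : ∀ μ, (xt μ).val = (xt' μ).val / P.L ^ n) (_hyy : ∀ μ, (yt μ).val = (yt' μ).val / P.L ^ n),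
      |topPiece (P.L ^ n * P.L ^ P.K) M (aK a P.L (P.K + n)) (((P.L ^ n * P.L ^ P.K : ℕ) : ℝ) ^ 2) m2 xt' yt'
          - topPiece (P.L ^ P.K) M (aK a P.L P.K) (((P.L ^ P.K : ℕ) : ℝ) ^ 2) m2 xt yt|
        ≤ (c * Real.sqrt ((prop38RateConst a a (lemma43Const a P.L P.K n) ((π ^ 2 / 4) ^ P.d) P.d γ
                + prop38PosConst a ((π ^ 2 / 4) ^ P.d) P.d γ) * ((P.L ^ P.K : ℕ) : ℝ) ^ (-γ))
            + c * ((P.L : ℝ) ^ P.K)⁻¹)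
          * Real.exp (-(δ * tdistT M (blockOf (P.L ^ P.K) M xt) (blockOf (P.L ^ P.K) M yt))) := by
  have hL1 : 1 < L := by omega
  obtain ⟨δ₀, c₀, hδ₀, hc₀, Hmin⟩ := minimiser_kernel_decay_blocks dd L hd ⟨hLodd, hL1⟩ ha hm.le
  obtain ⟨δ₁, c₁, hδ₁, hc₁, Hcov⟩ := covQstar_kernel_decay_blocks dd L hd hLodd hL ha hm
  obtain ⟨δ₂, c₂, hδ₂, hc₂, Hmr⟩ := king_prop38_torus_blocks dd L hd hLodd hL ha hm hγ0 hγ1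
  obtain ⟨δ₃, c₃, hδ₃, hc₃, Hcr⟩ := covQstar_row_rate dd L hd hLodd hL ha hm hγ0 hγ1
  -- common rate
  set μ₀ : ℝ := min (min δ₀ δ₁) (min (δ₂ / 2) δ₃) with hμ₀
  have hμ₀pos : 0 < μ₀ := lt_min (lt_min hδ₀ hδ₁) (lt_min (half_pos hδ₂) hδ₃)
  set δ : ℝ := μ₀ / 2 with hδdef
  have hδ0 : 0 < δ := half_pos hμ₀pos
  have hm1 : μ₀ ≤ δ₀ := (min_le_left _ _).trans (min_le_left _ _)
  have hm2 : μ₀ ≤ δ₁ := (min_le_left _ _).trans (min_le_right _ _)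
  have hm3 : μ₀ ≤ δ₂ / 2 := (min_le_right _ _).trans (min_le_left _ _)
  have hm4 : μ₀ ≤ δ₃ := (min_le_right _ _).trans (min_le_right _ _)
  have hδA : 2 * δ ≤ δ₀ := by rw [hδdef]; linarith
  have hδB : 2 * δ ≤ δ₁ := by rw [hδdef]; linarith
  have hδC : 2 * δ ≤ δ₂ / 2 := by rw [hδdef]; linarith
  have hδD : 2 * δ ≤ δ₃ := by rw [hδdef]; linarith
  set Kd := Balaban1983to89.B4Sect5Proof.latticeConst dd with hKd
  have hKdδ : 0 ≤ Kd δ := latticeConst_profile_nonneg dd δ hδ0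
  -- constant
  set c : ℝ := c₃ * (a * c₀) * Kd δ + c₁ * Real.sqrt (2 * (a * c₂)) * Kd δ + 1 with hcdef
  have hcA : c₃ * (a * c₀) * Kd δ ≤ c := by
    rw [hcdef]; have : 0 ≤ c₁ * Real.sqrt (2 * (a * c₂)) * Kd δ := by positivity
    linarith
  have hcB : c₃ * (a * c₀) * Kd δ + c₁ * Real.sqrt (2 * (a * c₂)) * Kd δ ≤ c := by rw [hcdef]; linarith
  refine ⟨δ, c, hδ0, by positivity, ?_⟩
  intro P hPd hPL hK _ n hn M _ hMK xt yt xt' yt' hxx hyy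
  have hLr : (1 : ℝ) < P.L := by exact_mod_cast P.hL.2
  have hN1 : 1 ≤ P.L ^ P.K := Nat.one_le_pow _ _ (by have := P.hL.2; omega)
  have haK : 0 < aK a P.L P.K := aK_pos ha hLr hK
  have haKn : 0 < aK a P.L (P.K + n) := aK_pos ha hLr (by omega)
  -- names
  set CA : Tor M → ℝ := fun b => covQstar (P.L ^ P.K) M (((P.L ^ P.K : ℕ) : ℝ) ^ 2) m2 (Pi.single b 1) xt with hCA
  set CB : Tor M → ℝ := fun b =>
    covQstar (P.L ^ n * P.L ^ P.K) M (((P.L ^ n * P.L ^ P.K : ℕ) : ℝ) ^ 2) m2 (Pi.single b 1) xt' with hCB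
  set HA : Tor M → ℝ := fun b =>
    minimiser (P.L ^ P.K) M (aK a P.L P.K) (((P.L ^ P.K : ℕ) : ℝ) ^ 2) m2 (Pi.single b 1) yt with hHA
  set HB : Tor M → ℝ := fun b =>
    minimiser (P.L ^ n * P.L ^ P.K) M (aK a P.L (P.K + n)) (((P.L ^ n * P.L ^ P.K : ℕ) : ℝ) ^ 2) m2
      (Pi.single b 1) yt' with hHB
  set X : ℝ := (prop38RateConst a a (lemma43Const a P.L P.K n) ((π ^ 2 / 4) ^ P.d) P.d γ
      + prop38PosConst a ((π ^ 2 / 4) ^ P.d) P.d γ) * ((P.L ^ P.K : ℕ) : ℝ) ^ (-γ) with hX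
  set bx := blockOf (P.L ^ P.K) M xt with hbx
  set byy := blockOf (P.L ^ P.K) M yt with hby
  set D : ℝ := tdistT M bx byy with hD
  -- kernel forms
  rw [topPiece_kernel_eq_sum (P.L ^ n * P.L ^ P.K) M haKn.le (by positivity) hm xt' yt',
    topPiece_kernel_eq_sum (P.L ^ P.K) M haK.le (by positivity) hm xt yt, ← Finset.sum_sub_distrib]
  -- run B as a volume `(d, L, m, K + n)` over the same unit torus
  have hMK' : ∀ μ, M μ = (⟨P.d, P.L, P.m, P.K + n, P.hd, P.hL⟩ : Params).sitesPerDir (P.K + n) := fun μ => by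
    rw [hMK μ]; exact (sitesPerDir_finerVolume P n).symm
  have hNB : P.L ^ n * P.L ^ P.K = P.L ^ (P.K + n) := by rw [pow_add, mul_comm]
  -- the four inputs
  have hCdiff : ∀ b, |CB b - CA b| ≤ (c₃ * Real.sqrt X + c₃ * ((P.L : ℝ) ^ P.K)⁻¹)
      * Real.exp (-(δ₃ * tdistT M bx b)) := fun b => Hcr P hPd hPL hK n hn M hMK xt xt' b hxx
  have hHBb : ∀ b, |HB b| ≤ a * c₀ * Real.exp (-(δ₀ * tdistT M b byy)) := fun b => by
    have h := Hmin (⟨P.d, P.L, P.m, P.K + n, P.hd, P.hL⟩ : Params) hPd hPL (show 1 ≤ P.K + n by omega) M hMK'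
      (P.L ^ n * P.L ^ P.K) hNB yt' b
    rw [blockOf_over M yt yt' hyy, tdistT_symm] at h
    exact h.trans (mul_le_mul_of_nonneg_right (mul_le_mul_of_nonneg_right
      (aK_le ha hLr (show 1 ≤ P.K + n by omega)) hc₀.le) (Real.exp_pos _).le)
  have hCAb : ∀ b, |CA b| ≤ c₁ * Real.exp (-(δ₁ * tdistT M bx b)) := fun b =>
    Hcov P hPd hPL hK M hMK (P.L ^ P.K) rfl xt b
  have hHdiff : ∀ b, |HB b - HA b| ≤ Real.sqrt (X * (2 * (a * c₂))) * Real.exp (-(δ₂ / 2 * tdistT M b byy)) :=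
    fun b => by
    have h := Hmr P hPd hPL hK n hn M hMK yt yt' b hyy
    rw [tdistT_symm] at h
    exact h
  -- termwise split
  have hpd : IsPseudoDist (tdistT M) := tdistT_isPseudoDist M
  have hR0 : 0 ≤ c₃ * Real.sqrt X + c₃ * ((P.L : ℝ) ^ P.K)⁻¹ := by positivity
  have hterm : ∀ b, |CB b * HB b - CA b * HA b|
      ≤ (c₃ * Real.sqrt X + c₃ * ((P.L : ℝ) ^ P.K)⁻¹) * (a * c₀)
          * (Real.exp (-(δ₃ * tdistT M bx b)) * Real.exp (-(δ₀ * tdistT M b byy)))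
        + c₁ * Real.sqrt (X * (2 * (a * c₂)))
          * (Real.exp (-(δ₁ * tdistT M bx b)) * Real.exp (-(δ₂ / 2 * tdistT M b byy))) := by
    intro b
    have e : CB b * HB b - CA b * HA b = (CB b - CA b) * HB b + CA b * (HB b - HA b) := by ring
    rw [e]
    refine (abs_add_le _ _).trans (add_le_add ?_ ?_)
    · rw [abs_mul]
      calc |CB b - CA b| * |HB b|
          ≤ ((c₃ * Real.sqrt X + c₃ * ((P.L : ℝ) ^ P.K)⁻¹) * Real.exp (-(δ₃ * tdistT M bx b)))
            * (a * c₀ * Real.exp (-(δ₀ * tdistT M b byy))) :=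
            mul_le_mul (hCdiff b) (hHBb b) (abs_nonneg _) (by positivity)
        _ = _ := by ring
    · rw [abs_mul]
      calc |CA b| * |HB b - HA b|
          ≤ (c₁ * Real.exp (-(δ₁ * tdistT M bx b)))
            * (Real.sqrt (X * (2 * (a * c₂))) * Real.exp (-(δ₂ / 2 * tdistT M b byy))) :=
            mul_le_mul (hCAb b) (hHdiff b) (abs_nonneg _) (by positivity)
        _ = _ := by ring
  -- the two convolutions
  have hconv1 := exp_conv_le hpd (tdistT_sumBound M) (κ₁ := δ₃) (κ₂ := δ₀) hδ0 hδD hδA bx byy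
  have hconv2 := exp_conv_le hpd (tdistT_sumBound M) (κ₁ := δ₁) (κ₂ := δ₂ / 2) hδ0 hδB hδC bx byy
  have hK' : Balaban1983to89.B4Sect5Proof.latticeConst P.d δ = Kd δ := by rw [hKd, hPd]
  rw [hK'] at hconv1 hconv2
  have hsqrt : Real.sqrt (X * (2 * (a * c₂))) = Real.sqrt X * Real.sqrt (2 * (a * c₂)) :=
    Real.sqrt_mul' _ (by positivity)
  calc |∑ b : Tor M, (CB b * HB b - CA b * HA b)|
      ≤ ∑ b : Tor M, |CB b * HB b - CA b * HA b| := Finset.abs_sum_le_sum_abs _ _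
    _ ≤ ∑ b : Tor M, ((c₃ * Real.sqrt X + c₃ * ((P.L : ℝ) ^ P.K)⁻¹) * (a * c₀)
          * (Real.exp (-(δ₃ * tdistT M bx b)) * Real.exp (-(δ₀ * tdistT M b byy)))
        + c₁ * Real.sqrt (X * (2 * (a * c₂)))
          * (Real.exp (-(δ₁ * tdistT M bx b)) * Real.exp (-(δ₂ / 2 * tdistT M b byy)))) :=
        Finset.sum_le_sum fun b _ => hterm b
    _ = (c₃ * Real.sqrt X + c₃ * ((P.L : ℝ) ^ P.K)⁻¹) * (a * c₀)
          * ∑ b : Tor M, Real.exp (-(δ₃ * tdistT M bx b)) * Real.exp (-(δ₀ * tdistT M b byy))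
        + c₁ * Real.sqrt (X * (2 * (a * c₂)))
          * ∑ b : Tor M, Real.exp (-(δ₁ * tdistT M bx b)) * Real.exp (-(δ₂ / 2 * tdistT M b byy)) := by
        rw [Finset.sum_add_distrib, Finset.mul_sum, Finset.mul_sum]
    _ ≤ (c₃ * Real.sqrt X + c₃ * ((P.L : ℝ) ^ P.K)⁻¹) * (a * c₀) * (Kd δ * Real.exp (-(δ * D)))
        + c₁ * Real.sqrt (X * (2 * (a * c₂))) * (Kd δ * Real.exp (-(δ * D))) :=
        add_le_add (mul_le_mul_of_nonneg_left hconv1 (by positivity))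
          (mul_le_mul_of_nonneg_left hconv2 (by positivity))
    _ = ((c₃ * (a * c₀) * Kd δ + c₁ * Real.sqrt (2 * (a * c₂)) * Kd δ) * Real.sqrt X
          + (c₃ * (a * c₀) * Kd δ) * ((P.L : ℝ) ^ P.K)⁻¹) * Real.exp (-(δ * D)) := by
        rw [hsqrt]; ring
    _ ≤ (c * Real.sqrt X + c * ((P.L : ℝ) ^ P.K)⁻¹) * Real.exp (-(δ * D)) := by
        refine mul_le_mul_of_nonneg_right (add_le_add ?_ ?_) (Real.exp_pos _).le
        · exact mul_le_mul_of_nonneg_right hcB (Real.sqrt_nonneg _)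
        · exact mul_le_mul_of_nonneg_right hcA (by positivity)

end Torus

end Literature.MathematicalPhysics.QuantumFieldTheory.King1986
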